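import Mathlib

/-!
# `LocalWeightedDrop`, line `nc-game-transport`, rung R2 (hyperplane arrangements): the NULLITY of a finite family of vectors and
# its coloop/core splitting (linear algebra only)

[OURS · L1 W4.3 · chain w43, engine crux `LocalWeightedDrop` stmt-ResolutionOfSingularities-8899; strategist res-L1-w43-strat-1's line
`nc-game-transport`, TOT rung R2 «hyperplane arrangements» (spec `L/res-L1-w43-strat-1/TOT-RUNGS-SPEC.md` §R2); res-type-088.]  Folklore
linear algebra over a field `k`, in the shapes the arrangement game (`…NCArrangements`) consumes; nothing here is a statement of any
manuscript, and the measure below is OURS (the spec's `|A| − #components` is replaced by the NULLITY `|A| − rank`, which needs no matroid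
connectivity: the centre of the game's move is the flat of the CORE = the family minus its coloops).

For a family `a : ι → V` and a finite index set `s`:
* `nullity k a s = s.card − finrank (span (a '' s))` — `finrank_span_image_le_card`; `= 0` ⇒ the sub-family is linearly independent
  (`linearIndependent_of_nullity_eq_zero`); congruence; ADDITIVITY over disjoint index sets whose spans meet trivially (`nullity_union`);
  INVARIANCE under linear maps injective on the span (`nullity_comp_eq`).
* COLOOPS `coloops k a s = {j ∈ s : a j ∉ span (a '' (s ∖ j))}` and the CORE `core k a s = s ∖ coloops`: the spans of core and coloops
  meet trivially (`disjoint_span_core_coloops`); the core is COLOOP-FREE in itself (`mem_span_core_erase`) and non-empty as soon as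
  the nullity is positive (`core_nonempty`).
* THE DROP: in a coloop-free family every PROPER sub-family has strictly smaller nullity (`nullity_lt_of_ssubset`).
-/

set_option linter.dupNamespace false -- mandated namespace of this single-conjunct summit

namespace Summit.ResolutionOfSingularities.ResolutionOfSingularities.Theorems

namespace NCArrangement

open Module Submodule

/-- The image of a finite index set is the range of the restricted family. -/
theorem image_coe_eq_range {V ι : Type} (a : ι → V) (s : Finset ι) : a '' (↑s : Set ι) = Set.range (fun j : ↥s => a j) := by
  ext x
  simp only [Set.mem_image, Finset.mem_coe, Set.mem_range, Subtype.exists, exists_prop]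

variable {k : Type} [Field k] {V : Type} [AddCommGroup V] [Module k V]
variable {ι : Type}

/-! ## Nullity -/

variable (k) in
/-- The NULLITY of the finite family `(a j)_{j ∈ s}`: the number of vectors minus the dimension of their span. [OURS · folklore] -/
noncomputable def nullity (a : ι → V) (s : Finset ι) : ℕ :=
  s.card - finrank k (span k (a '' (↑s : Set ι)))

/-- The span of finitely many vectors has dimension at most their number. [folklore] -/
theorem finrank_span_image_le_card (a : ι → V) (s : Finset ι) :
    finrank k (span k (a '' (↑s : Set ι))) ≤ s.card := by
  rw [image_coe_eq_range]
  exact (finrank_range_le_card (R := k) _).trans (le_of_eq (Fintype.card_coe s))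

/-- Unfolding the nullity as an equation in `ℕ` (no truncation). -/
theorem nullity_add_finrank (a : ι → V) (s : Finset ι) :
    nullity k a s + finrank k (span k (a '' (↑s : Set ι))) = s.card := by
  unfold nullity
  have := finrank_span_image_le_card (k := k) a s
  omega

/-- Nullity zero means the sub-family is linearly independent. [folklore] -/
theorem linearIndependent_of_nullity_eq_zero {a : ι → V} {s : Finset ι} (h : nullity k a s = 0) :
    LinearIndependent k (fun j : ↥s => a j) := by
  rw [linearIndependent_iff_card_eq_finrank_span, Set.finrank, ← image_coe_eq_range, Fintype.card_coe]
  have := nullity_add_finrank (k := k) a s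
  omega

/-- The nullity depends only on the values on `s`. -/
theorem nullity_congr {a b : ι → V} {s : Finset ι} (h : ∀ j ∈ s, a j = b j) : nullity k a s = nullity k b s := by
  unfold nullity
  rw [Set.image_congr (fun j hj => h j hj)]

/-- Membership in the span of a finite sub-family as a finite linear combination. [folklore] -/
theorem mem_span_image_iff {a : ι → V} {s : Finset ι} {x : V} :
    x ∈ span k (a '' (↑s : Set ι)) ↔ ∃ c : ι → k, ∑ j ∈ s, c j • a j = x := by
  classical
  constructor
  · intro hx
    rw [image_coe_eq_range, Submodule.mem_span_range_iff_exists_fun] at hx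
    obtain ⟨c, hc⟩ := hx
    refine ⟨fun j => if h : j ∈ s then c ⟨j, h⟩ else 0, ?_⟩
    rw [← hc, ← Finset.sum_coe_sort s]
    refine Finset.sum_congr rfl fun j _ => ?_
    simp only [dif_pos j.2, Subtype.coe_eta]
  · rintro ⟨c, rfl⟩
    exact Submodule.sum_mem _ fun j hj => Submodule.smul_mem _ _ (subset_span ⟨j, hj, rfl⟩)

/-- ADDITIVITY: over disjoint index sets whose spans meet trivially the nullity adds up. [folklore] -/
theorem nullity_union [FiniteDimensional k V] [DecidableEq ι] {a : ι → V} {s t : Finset ι} (hst : Disjoint s t)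
    (hsp : Disjoint (span k (a '' (↑s : Set ι))) (span k (a '' (↑t : Set ι)))) :
    nullity k a (s ∪ t) = nullity k a s + nullity k a t := by
  have hs := nullity_add_finrank (k := k) a s
  have ht := nullity_add_finrank (k := k) a t
  have hu := nullity_add_finrank (k := k) a (s ∪ t)
  have hcard : (s ∪ t).card = s.card + t.card := Finset.card_union_of_disjoint hst
  have hspan : span k (a '' (↑(s ∪ t) : Set ι)) = span k (a '' (↑s : Set ι)) ⊔ span k (a '' (↑t : Set ι)) := by
    rw [Finset.coe_union, Set.image_union, Submodule.span_union]
  have hdim : finrank k (span k (a '' (↑(s ∪ t) : Set ι))) =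
      finrank k (span k (a '' (↑s : Set ι))) + finrank k (span k (a '' (↑t : Set ι))) := by
    rw [hspan, ← Submodule.finrank_sup_add_finrank_inf_eq, hsp.eq_bot, finrank_bot, add_zero]
  omega

/-- INVARIANCE: a linear map injective on the span does not change the nullity. [folklore] -/
theorem nullity_comp_eq {V' : Type} [AddCommGroup V'] [Module k V'] (f : V →ₗ[k] V')
    {a : ι → V} {s : Finset ι} (hf : ∀ v ∈ span k (a '' (↑s : Set ι)), f v = 0 → v = 0) :
    nullity k (fun j => f (a j)) s = nullity k a s := by
  have h1 := nullity_add_finrank (k := k) a s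
  have h2 := nullity_add_finrank (k := k) (fun j => f (a j)) s
  have himg : (fun j => f (a j)) '' (↑s : Set ι) = f '' (a '' (↑s : Set ι)) := by
    rw [Set.image_image]
  have hspan : span k ((fun j => f (a j)) '' (↑s : Set ι)) = (span k (a '' (↑s : Set ι))).map f := by
    rw [himg, Submodule.span_image]
  have hinj : Function.Injective (f.domRestrict (span k (a '' (↑s : Set ι)))) := by
    rw [injective_iff_map_eq_zero]
    intro v hv
    exact Subtype.ext (hf v.1 v.2 hv)
  have hdim : finrank k (span k ((fun j => f (a j)) '' (↑s : Set ι))) = finrank k (span k (a '' (↑s : Set ι))) := by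
    rw [hspan, ← LinearMap.range_domRestrict, LinearMap.finrank_range_of_inj hinj]
  omega

/-! ## Coloops and the core -/

variable (k) in
/-- The COLOOPS of the family on `s`: the indices whose vector is NOT in the span of the others. [folklore] -/
noncomputable def coloops [DecidableEq ι] (a : ι → V) (s : Finset ι) : Finset ι :=
  @Finset.filter ι (fun j => a j ∉ span k (a '' (↑(s.erase j) : Set ι))) (Classical.decPred _) s

variable (k) in
/-- The CORE of the family on `s`: the indices whose vector IS in the span of the others. [folklore] -/
noncomputable def core [DecidableEq ι] (a : ι → V) (s : Finset ι) : Finset ι :=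
  @Finset.filter ι (fun j => a j ∈ span k (a '' (↑(s.erase j) : Set ι))) (Classical.decPred _) s

variable [DecidableEq ι] {a : ι → V} {s : Finset ι}

/-- Membership in the coloops. -/
theorem mem_coloops {j : ι} : j ∈ coloops k a s ↔ j ∈ s ∧ a j ∉ span k (a '' (↑(s.erase j) : Set ι)) := by
  unfold coloops
  exact @Finset.mem_filter ι _ (Classical.decPred _) s j

/-- Membership in the core. -/
theorem mem_core {j : ι} : j ∈ core k a s ↔ j ∈ s ∧ a j ∈ span k (a '' (↑(s.erase j) : Set ι)) := by
  unfold core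
  exact @Finset.mem_filter ι _ (Classical.decPred _) s j

/-- The coloops lie in `s`. -/
theorem coloops_subset : coloops k a s ⊆ s := fun _ hj => (mem_coloops.mp hj).1

/-- The core lies in `s`. -/
theorem core_subset : core k a s ⊆ s := fun _ hj => (mem_core.mp hj).1

/-- `s` is the union of its core and its coloops. -/
theorem core_union_coloops : core k a s ∪ coloops k a s = s := by
  ext j
  rw [Finset.mem_union, mem_core, mem_coloops]
  tauto

/-- Core and coloops are disjoint. -/
theorem disjoint_core_coloops : Disjoint (core k a s) (coloops k a s) := by
  rw [Finset.disjoint_left]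
  intro j hjc hjl
  exact (mem_coloops.mp hjl).2 (mem_core.mp hjc).2

/-- For a core index `j`: `s ∖ j = (core ∖ j) ∪ coloops`. -/
theorem erase_eq_core_erase_union_coloops {j : ι} (hj : j ∈ core k a s) :
    s.erase j = (core k a s).erase j ∪ coloops k a s := by
  ext i
  rw [Finset.mem_union, Finset.mem_erase, Finset.mem_erase]
  constructor
  · rintro ⟨hij, his⟩
    rw [← core_union_coloops (k := k) (a := a) (s := s), Finset.mem_union] at his
    rcases his with hic | hil
    · exact Or.inl ⟨hij, hic⟩
    · exact Or.inr hil
  · rintro (⟨hij, hic⟩ | hil)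
    · exact ⟨hij, core_subset hic⟩
    · refine ⟨?_, coloops_subset hil⟩
      rintro rfl
      exact Finset.disjoint_left.mp disjoint_core_coloops hj hil

/-- THE SPANS OF CORE AND COLOOPS MEET TRIVIALLY. [folklore] -/
theorem disjoint_span_core_coloops :
    Disjoint (span k (a '' (↑(core k a s) : Set ι))) (span k (a '' (↑(coloops k a s) : Set ι))) := by
  rw [disjoint_iff_inf_le]
  intro x hx
  obtain ⟨hxc, hxl⟩ := Submodule.mem_inf.mp hx
  obtain ⟨c, hc⟩ := mem_span_image_iff.mp hxl
  rw [Submodule.mem_bot]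
  by_contra hx0
  -- some coloop coefficient is non-zero
  obtain ⟨j₀, hj₀, hcj₀⟩ : ∃ j₀ ∈ coloops k a s, c j₀ ≠ 0 := by
    by_contra h
    push Not at h
    apply hx0
    rw [← hc]
    exact Finset.sum_eq_zero fun j hj => by rw [h j hj, zero_smul]
  apply (mem_coloops.mp hj₀).2
  -- `a j₀ = c j₀⁻¹ • (x − Σ_{j ≠ j₀} c j • a j)` lies in the span of the others
  have hsum : c j₀ • a j₀ + ∑ j ∈ (coloops k a s).erase j₀, c j • a j = x := by
    rw [Finset.add_sum_erase _ (fun j => c j • a j) hj₀, hc]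
  have hrest : ∑ j ∈ (coloops k a s).erase j₀, c j • a j ∈ span k (a '' (↑(s.erase j₀) : Set ι)) :=
    Submodule.sum_mem _ fun j hj => Submodule.smul_mem _ _ (subset_span ⟨j,
      Finset.mem_erase.mpr ⟨(Finset.mem_erase.mp hj).1, coloops_subset (Finset.mem_erase.mp hj).2⟩, rfl⟩)
  have hxin : x ∈ span k (a '' (↑(s.erase j₀) : Set ι)) := by
    refine Submodule.span_mono (Set.image_mono ?_) hxc
    intro j hj
    refine Finset.mem_erase.mpr ⟨?_, core_subset hj⟩
    rintro rfl
    exact Finset.disjoint_left.mp disjoint_core_coloops hj hj₀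
  have key : a j₀ = (c j₀)⁻¹ • (x - ∑ j ∈ (coloops k a s).erase j₀, c j • a j) := by
    rw [← hsum, add_sub_cancel_right, smul_smul, inv_mul_cancel₀ hcj₀, one_smul]
  rw [key]
  exact Submodule.smul_mem _ _ (Submodule.sub_mem _ hxin hrest)

/-- THE CORE IS COLOOP-FREE IN ITSELF: every core vector lies in the span of the other core vectors. [folklore] -/
theorem mem_span_core_erase {j : ι} (hj : j ∈ core k a s) :
    a j ∈ span k (a '' (↑((core k a s).erase j) : Set ι)) := by
  have hin := (mem_core.mp hj).2
  rw [erase_eq_core_erase_union_coloops hj, Finset.coe_union, Set.image_union, Submodule.span_union] at hin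
  obtain ⟨y, hy, z, hz, hyz⟩ := Submodule.mem_sup.mp hin
  have hzcore : z ∈ span k (a '' (↑(core k a s) : Set ι)) := by
    have hz' : z = a j - y := by rw [← hyz]; abel
    rw [hz']
    exact Submodule.sub_mem _ (subset_span ⟨j, hj, rfl⟩)
      (Submodule.span_mono (Set.image_mono (Finset.erase_subset _ _)) hy)
  have hz0 : z = 0 := by
    have h := disjoint_span_core_coloops (k := k) (a := a) (s := s)
    rw [disjoint_iff_inf_le] at h
    exact (Submodule.mem_bot k).mp (h (Submodule.mem_inf.mpr ⟨hzcore, hz⟩))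
  rw [hz0, add_zero] at hyz
  rw [← hyz]
  exact hy

/-- If every index is a coloop the family on `s` is linearly independent, so the nullity vanishes; contrapositively a
POSITIVE NULLITY FORCES A NON-EMPTY CORE. [folklore] -/
theorem core_nonempty (h : 0 < nullity k a s) : (core k a s).Nonempty := by
  by_contra hempty
  rw [Finset.not_nonempty_iff_eq_empty] at hempty
  have hall : ∀ j ∈ s, a j ∉ span k (a '' (↑(s.erase j) : Set ι)) := by
    intro j hj hn
    have : j ∈ core k a s := mem_core.mpr ⟨hj, hn⟩
    rw [hempty] at this
    exact Finset.notMem_empty j this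
  -- linear independence of the family on `s`
  have hli : LinearIndependent k (fun j : ↥s => a j) := by
    rw [linearIndependent_iff_notMem_span]
    intro j hj
    apply hall j j.2
    refine Submodule.span_mono ?_ hj
    rintro _ ⟨i, hi, rfl⟩
    have hne : i ≠ j := fun h => hi.2 (by rw [h]; rfl)
    exact ⟨(i : ι), Finset.mem_erase.mpr ⟨fun h => hne (Subtype.ext h), i.2⟩, rfl⟩
  have hcard := linearIndependent_iff_card_eq_finrank_span.mp hli
  rw [Set.finrank, ← image_coe_eq_range, Fintype.card_coe] at hcard
  have := nullity_add_finrank (k := k) a s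
  omega

omit [DecidableEq ι] in
/-- Nullity is monotone along sub-families, quantitatively: `nullity F + (|B ∖ F| − …) …` — the weak inequality. [folklore] -/
theorem nullity_mono [FiniteDimensional k V] {B F : Finset ι} (hFB : F ⊆ B) : nullity k a F ≤ nullity k a B := by
  classical
  have hF := nullity_add_finrank (k := k) a F
  have hBn := nullity_add_finrank (k := k) a B
  have hcard : B.card = F.card + (B \ F).card := by
    rw [← Finset.card_union_of_disjoint Finset.disjoint_sdiff, Finset.union_sdiff_of_subset hFB]
  have hspanB : span k (a '' (↑B : Set ι)) = span k (a '' (↑F : Set ι)) ⊔ span k (a '' (↑(B \ F) : Set ι)) := by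
    rw [← Submodule.span_union, ← Set.image_union, ← Finset.coe_union, Finset.union_sdiff_of_subset hFB]
  have hle := Submodule.finrank_add_le_finrank_add_finrank (span k (a '' (↑F : Set ι))) (span k (a '' (↑(B \ F) : Set ι)))
  rw [← hspanB] at hle
  have hDle := finrank_span_image_le_card (k := k) a (B \ F)
  omega

/-- THE DROP: in a COLOOP-FREE family every proper sub-family has strictly smaller nullity. [folklore] -/
theorem nullity_lt_of_ssubset [FiniteDimensional k V] {B F : Finset ι} (hB : ∀ j ∈ B, a j ∈ span k (a '' (↑(B.erase j) : Set ι)))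
    (hFB : F ⊂ B) : nullity k a F < nullity k a B := by
  set D := B \ F with hD
  have hFD : Disjoint F D := Finset.disjoint_sdiff
  have hBFD : B = F ∪ D := by rw [hD, Finset.union_sdiff_of_subset hFB.1]
  have hDne : D.Nonempty := by
    rw [hD, Finset.sdiff_nonempty]
    exact fun h => hFB.2 h
  have hF := nullity_add_finrank (k := k) a F
  have hBn := nullity_add_finrank (k := k) a B
  have hcard : B.card = F.card + D.card := by rw [hBFD, Finset.card_union_of_disjoint hFD]
  have hspanB : span k (a '' (↑B : Set ι)) = span k (a '' (↑F : Set ι)) ⊔ span k (a '' (↑D : Set ι)) := by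
    rw [hBFD, Finset.coe_union, Set.image_union, Submodule.span_union]
  have hsup := Submodule.finrank_sup_add_finrank_inf_eq (span k (a '' (↑F : Set ι))) (span k (a '' (↑D : Set ι)))
  have hDle := finrank_span_image_le_card (k := k) a D
  rw [← hspanB] at hsup
  refine lt_of_le_of_ne (nullity_mono hFB.1) fun heq => ?_
  -- the equality case: `D` is independent and its span meets `span F` trivially
  have heq1 : finrank k (span k (a '' (↑D : Set ι))) = D.card := by omega
  have heq2 : finrank k ↥(span k (a '' (↑F : Set ι)) ⊓ span k (a '' (↑D : Set ι))) = 0 := by omega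
  have hinf : span k (a '' (↑F : Set ι)) ⊓ span k (a '' (↑D : Set ι)) = ⊥ := Submodule.finrank_eq_zero.mp heq2
  have hliD : LinearIndependent k (fun j : ↥D => a j) := by
    rw [linearIndependent_iff_card_eq_finrank_span, Set.finrank, ← image_coe_eq_range, Fintype.card_coe, heq1]
  obtain ⟨j, hjD⟩ := hDne
  have hjB : j ∈ B := Finset.sdiff_subset hjD
  have hjF : j ∉ F := (Finset.mem_sdiff.mp hjD).2
  -- `a j ∈ span F ⊔ span (D ∖ j)`
  have hsplit : B.erase j = F ∪ D.erase j := by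
    rw [hBFD, Finset.erase_union_distrib, Finset.erase_eq_of_notMem hjF]
  have hj := hB j hjB
  rw [hsplit, Finset.coe_union, Set.image_union, Submodule.span_union] at hj
  obtain ⟨y, hy, z, hz, hyz⟩ := Submodule.mem_sup.mp hj
  have hyD : y ∈ span k (a '' (↑D : Set ι)) := by
    have hy' : y = a j - z := by rw [← hyz]; abel
    rw [hy']
    exact Submodule.sub_mem _ (subset_span ⟨j, hjD, rfl⟩)
      (Submodule.span_mono (Set.image_mono (Finset.erase_subset _ _)) hz)
  have hy0 : y = 0 := by
    have : y ∈ span k (a '' (↑F : Set ι)) ⊓ span k (a '' (↑D : Set ι)) := Submodule.mem_inf.mpr ⟨hy, hyD⟩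
    rw [hinf] at this
    exact (Submodule.mem_bot k).mp this
  rw [hy0, zero_add] at hyz
  -- contradiction with the linear independence of the family on `D`
  have hnot := (linearIndependent_iff_notMem_span.mp hliD) ⟨j, hjD⟩
  apply hnot
  rw [hyz] at hz
  refine Submodule.span_mono ?_ hz
  rintro _ ⟨i, hi, rfl⟩
  obtain ⟨hij, hiD⟩ := Finset.mem_erase.mp hi
  refine ⟨⟨i, hiD⟩, ?_, rfl⟩
  simp only [Set.mem_sdiff, Set.mem_univ, Set.mem_singleton_iff, true_and]
  exact fun h => hij (congrArg Subtype.val h)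

end NCArrangement

end Summit.ResolutionOfSingularities.ResolutionOfSingularities.Theorems
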